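import Summits.CriticalPhenomena.PercolationContinuityZ3.Theorems.PercNearOneGluingNoHeavyLowerTailAntitheticPieces
import HarnessLib

/-!
# `NoHeavyLowerTail` (stmt-CriticalPhenomena-4575) — antithetic cluster pairs: the PARALLEL-COMPOSITION (hub) lemma
# behind THEOREM H (theta graphs), prim-hp-2 gen 35 (MEMO-gen35 §1–§2, THEOREM-H-theta.md Lemma 2 / 2')

Support file (`--supports stmt-CriticalPhenomena-4575`, hull-port prover `prim-hp-2`, gen 35).  No definitions of record, no named
facts, no sorries; standard axioms.

Setting: as in the gen-31/32/34 files (`…AntitheticHarris`, `…AntitheticPieces`, `…AntitheticClassCover`): a PIECE is a family of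
colourings indexed by the subsets `S` of a finite block set along which the red cluster of the source is ANTITONE; the piece lemma
(`Antithetic.piece_abstract`) then gives a nonnegative antithetic sum over the family.  THEOREM H (gen 35: the antithetic sum
`Σ_{D(X,R)} Δ ≥ 0` on every THETA GRAPH — source `s`, hub `c`, any number of internally disjoint `s–c` paths) is proved by an explicit
partition of `D(X,R)` into products of per-leg "two-terminal cubes".  The only order-theoretic input beyond the piece lemma is the
validity of such products, isolated here in abstract form:

* `Antithetic.antitone_sup_ite` — the HUB FORMULA: if `A, B : P → α` are antitone and `conn : P → Prop` is a down-set ("some leg still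
  joins the source to the hub"), then `S ↦ A S ⊔ (if conn S then B S else ⊥)` is antitone.  (Red cluster of a theta graph = source-side
  reaches of the legs `⊔` [hub reached] · (hub `⊔` hub-side reaches).)
* `Antithetic.antitone_iSup_apply` — joins of antitone leg contributions are antitone.
* `Antithetic.parallel_antitone` — the product over legs: blocks `Σ i, β i`, per-leg source reach `Rs i`, union reach `Ru i` (both antitone
  in the leg's own flipped blocks) and connection predicates `κ i` (down-closed); the assembled red cluster is antitone in the flipped set.
* `Antithetic.piece_parallel_sum_nonneg` — hence the antithetic sum over such a product cube is `≥ 0` (piece lemma), and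
  `Antithetic.piece_tied_sum_nonneg` — the same over any TIED sub-cube (blocks glued along a monotone re-indexing `u : Set γ → P`, e.g.
  unions of the parts of a partition of the blocks: the "bundle" of THEOREM-H-theta.md Lemma 2').
[cite: VandenbergHaggstromKahn2005, §1 p. 6 ("Harris' inequality")]
-/

noncomputable section

namespace Summit.CriticalPhenomena.PercolationContinuityZ3.Theorems

open scoped Classical

namespace Antithetic

section Hub

variable {P : Type*} [Preorder P] {α : Type*}

/-- **Hub formula.**  `A, B : P → α` antitone and `conn` a down-set of `P` ⇒ `S ↦ A S ⊔ (if conn S then B S else ⊥)` is antitone.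
(If the larger index still connects, so does the smaller and both terms shrink; otherwise the larger index contributes only `A`.)
[folklore] -/
theorem antitone_sup_ite [SemilatticeSup α] [OrderBot α] (A B : P → α) (conn : P → Prop) (hA : Antitone A) (hB : Antitone B)
    (hconn : ∀ S S', S ≤ S' → conn S' → conn S) :
    Antitone fun S => A S ⊔ (if conn S then B S else ⊥) := by
  intro S S' h
  dsimp only
  by_cases h' : conn S'
  · have hS : conn S := hconn S S' h h'
    rw [if_pos h', if_pos hS]
    exact sup_le_sup (hA h) (hB h)
  · rw [if_neg h']
    simp only [sup_bot_eq]
    exact (hA h).trans le_sup_left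

/-- A pointwise join of antitone maps into a complete lattice is antitone. [folklore] -/
theorem antitone_iSup_apply [CompleteLattice α] {ι : Sort*} (f : ι → P → α) (hf : ∀ i, Antitone (f i)) :
    Antitone fun S => ⨆ i, f i S := fun _ _ h => iSup_mono fun i => hf i h

end Hub

section Parallel

variable {ι : Type*} {β : ι → Type*} {α : Type*} [CompleteLattice α]

/-- The flipped blocks of leg `i`, `Sigma.mk i ⁻¹' S`, form a monotone function of the flipped set `S ⊆ Σ i, β i`. [folklore] -/
theorem legPart_mono (i : ι) : Monotone fun S : Set (Σ i, β i) => Sigma.mk i ⁻¹' S := fun _ _ h => Set.preimage_mono h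

/-- **Parallel composition (THEOREM-H-theta.md, Lemma 2).**  Legs `i : ι` with block sets `β i`; for each leg a source reach `Rs i` and a
union reach `Ru i` (source reach `⊔` hub reach), both antitone in the leg's flipped blocks, and a connection predicate `κ i` ("the leg
joins source and hub in red") which is down-closed.  Then the red cluster of the parallel composition,
`S ↦ (⨆ i, Rs i Sᵢ) ⊔ (if ∃ i, κ i Sᵢ then C ⊔ ⨆ i, Ru i Sᵢ else ⊥)` (`Sᵢ = Sigma.mk i ⁻¹' S`, `C` = the hub's own contribution),
is antitone in the flipped set `S ⊆ Σ i, β i`. [this work] -/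
theorem parallel_antitone (Rs Ru : ∀ i, Set (β i) → α) (κ : ∀ i, Set (β i) → Prop) (C : α)
    (hRs : ∀ i, Antitone (Rs i)) (hRu : ∀ i, Antitone (Ru i))
    (hκ : ∀ i (S S' : Set (β i)), S ⊆ S' → κ i S' → κ i S) :
    Antitone fun S : Set (Σ i, β i) =>
      (⨆ i, Rs i (Sigma.mk i ⁻¹' S)) ⊔ (if ∃ i, κ i (Sigma.mk i ⁻¹' S) then C ⊔ ⨆ i, Ru i (Sigma.mk i ⁻¹' S) else ⊥) := by
  refine antitone_sup_ite (fun S => ⨆ i, Rs i (Sigma.mk i ⁻¹' S)) (fun S => C ⊔ ⨆ i, Ru i (Sigma.mk i ⁻¹' S))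
    (fun S => ∃ i, κ i (Sigma.mk i ⁻¹' S)) ?_ ?_ ?_
  · exact antitone_iSup_apply (fun i S => Rs i (Sigma.mk i ⁻¹' S)) fun i => (hRs i).comp_monotone (legPart_mono i)
  · exact fun S S' h => sup_le_sup_left
      (antitone_iSup_apply (fun i S => Ru i (Sigma.mk i ⁻¹' S)) (fun i => (hRu i).comp_monotone (legPart_mono i)) h) C
  · rintro S S' h ⟨i, hi⟩
    exact ⟨i, hκ i _ _ (legPart_mono i h) hi⟩

/-- **Antithetic sum over a product of leg cubes** (piece lemma + `parallel_antitone`): for monotone `F, G : α → ℝ` the sum over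
all `S ⊆ Σ i, β i` of `(F(W S) − F(W Sᶜ))(G(W S) − G(W Sᶜ))`, `W` the assembled red cluster, is nonnegative. [this work] -/
theorem piece_parallel_sum_nonneg [Fintype (Σ i, β i)] (Rs Ru : ∀ i, Set (β i) → α) (κ : ∀ i, Set (β i) → Prop) (C : α)
    (hRs : ∀ i, Antitone (Rs i)) (hRu : ∀ i, Antitone (Ru i))
    (hκ : ∀ i (S S' : Set (β i)), S ⊆ S' → κ i S' → κ i S) {F G : α → ℝ} (hF : Monotone F) (hG : Monotone G) :
    let W : Set (Σ i, β i) → α := fun S =>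
      (⨆ i, Rs i (Sigma.mk i ⁻¹' S)) ⊔ (if ∃ i, κ i (Sigma.mk i ⁻¹' S) then C ⊔ ⨆ i, Ru i (Sigma.mk i ⁻¹' S) else ⊥)
    0 ≤ ∑ S : Set (Σ i, β i), (F (W S) - F (W Sᶜ)) * (G (W S) - G (W Sᶜ)) :=
  piece_abstract _ (parallel_antitone Rs Ru κ C hRs hRu hκ) hF hG

end Parallel

section Tied

variable {γ : Type*} [Fintype γ] {P : Type*} [Preorder P] {α : Type*} [Preorder α]

/-- **Tied sub-cubes (THEOREM-H-theta.md, Lemma 2' "bundle").**  If `Φ : P → α` is antitone (e.g. the assembled red cluster of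
`parallel_antitone`) and `u : Set γ → P` is monotone (e.g. `Q ↦ ⋃ Q` for a partition of the blocks into tied parts indexed by `γ`), then
the antithetic sum over the tied cube `Set γ` is nonnegative. [this work] -/
theorem piece_tied_sum_nonneg (Φ : P → α) (hΦ : Antitone Φ) (u : Set γ → P) (hu : Monotone u) {F G : α → ℝ} (hF : Monotone F)
    (hG : Monotone G) :
    0 ≤ ∑ Q : Set γ, (F (Φ (u Q)) - F (Φ (u Qᶜ))) * (G (Φ (u Q)) - G (Φ (u Qᶜ))) :=
  piece_abstract (Φ ∘ u) (hΦ.comp_monotone hu) hF hG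

end Tied

end Antithetic

end Summit.CriticalPhenomena.PercolationContinuityZ3.Theorems
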